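import Literature.AnabelianGeometry.AbsoluteAnabelian.AbsTopIThm26vFullClosers
import Literature.AnabelianGeometry.AbsoluteAnabelian.AbsTopIAlmostProSigmaBridge
import HarnessLib

/-!
# [AbsTopI] Thm 2.6 (v), general `Θ`, for a `Δ` that is only ALMOST pro-`Σ` (the Def 2.1 (i) datum)

S. Mochizuki, *Topics in Absolute Anabelian Geometry I: Generalities* (2012) [AbsTopI] (lit key
`paper:url-11ac98ba15fc`), Def 1.1 (iii) p. 10, Def 2.1 (i) p. 17, Thm 2.6 (v) p. 22 and its proof p. 24.

PROOF-ONLY sequel of `AbsTopIAlmostProSigmaBridge.lean` (abc-iut-w6-d071, L4 row «THM26-ALMOST-PROSIGMA»; L4-lead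
«GO bridges … then (iv)/(v)»): the general-`Θ` closers of Thm 2.6 (v) (abc-iut-w6-d034's `AbsTopIThm26vFullCore` /
`AbsTopIThm26vFullClosers`, p438xxx) take the construction datum as `IsProSet E.geom S` ("`Δ` PRO-`Σ`"); print's
Def 2.1 (i) makes `Δ` only ALMOST pro-`Σ`.  The core `zetaTildeInv_eq_of_inputs` uses pro-`Σ`-ness at ONE point — in
the regime "some prime `q ∉ Σ`", to see that `Δ` is almost pro-omissive — where an open pro-`Σ` subgroup suffices
(`IsAlmostPro.isAlmostProOmissive_of_prime_not_mem`, mechanism (M2) of the bridge file); in the regime "all primes in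
`Σ`" the pro-`Σ` hypothesis is vacuous.  Hence:

* `zetaTildeInv_eq_of_inputs_of_isAlmostPro` — the core re-keyed on `IsAlmostPro (Ker a) S` (all-primes branch:
  the landed core with the vacuous `IsProSet`; `q ∉ Σ` branch: verbatim the landed argument with (M2));
* `MLFBase.zetaTildeInv_eq_of_isOpen_of_isAlmostPro`, `MLFBase.zetaTildeInv_arith_eq_of_isAlmostPro`,
  `MLFBase.thm26vFull_of_rank_of_thm26iii_open_of_isAlmostPro` — the three general-`Θ` closers of
  `AbsTopIThm26vFullClosers.lean` with `hΔS : IsAlmostPro E.geom S` (passage to `Δ ∩ H` by (M3),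
  `FundamentalExtension.isAlmostPro_geom_inf_of_isOpen`), everything else consumed BY NAME.

The input (I4) «Thm 2.6 (iii) for every open `H ⊆ Π`» stays a binder exactly as in the landed closers (its clause 1
is the one place where the tree's proof uses pro-`Σ`-ness essentially — census 12:2xZ).  HONEST SCOPE: closers modulo
the named inputs (I3) rank identity and (I4); refereed, undisputed statement; nothing here bears on [IUTchIII]
Cor. 3.12; no side is taken.
-/

noncomputable section

open Topology

namespace Literature.AnabelianGeometry.AbsoluteAnabelian

universe u v

section Core

variable {Λ : Type u} [Group Λ] [TopologicalSpace Λ] [IsTopologicalGroup Λ]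
variable {Γ : Type v} [Group Γ] [TopologicalSpace Γ] [IsTopologicalGroup Γ] [T2Space Γ]

omit [IsTopologicalGroup Γ] in
/-- For a continuous surjection `a : G ↠ Γ` from a compact group onto a Hausdorff group, the
quotient of `Λ` by (copy of the private lemma of `AbsTopIThm26vFullCore`) a normal subgroup EQUAL to `Ker a` is bicontinuously isomorphic to `Γ`.
[folklore] -/
private theorem nonempty_continuousMulEquiv_quotient_of_eq_ker_copy [CompactSpace Λ] (a : Λ →ₜ* Γ)
    (ha : Function.Surjective a) (N : Subgroup Λ) [N.Normal] (hN : N = a.toMonoidHom.ker) :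
    Nonempty (Λ ⧸ N ≃ₜ* Γ) := by
  subst hN
  let e₀ : Λ ⧸ a.toMonoidHom.ker ≃* Γ := QuotientGroup.quotientKerEquivOfSurjective a.toMonoidHom ha
  have hc : Continuous e₀ := by
    rw [← QuotientGroup.isOpenQuotientMap_mk.continuous_comp_iff]
    have : (e₀ : Λ ⧸ a.toMonoidHom.ker → Γ) ∘ QuotientGroup.mk = a := funext fun _ => rfl
    rw [this]
    exact a.continuous
  let h : Λ ⧸ a.toMonoidHom.ker ≃ₜ Γ := hc.homeoOfEquivCompactToT2 (f := e₀.toEquiv)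
  exact ⟨{ e₀ with
    continuous_toFun := h.continuous
    continuous_invFun := h.symm.continuous }⟩

/-- **The core of [AbsTopI] Thm 2.6 (v) (p. 24 l. 4–22) for an abstract compact `Λ ↠ Γ` whose kernel `Δ` is only
ALMOST pro-`Σ`** — same statement as abc-iut-w6-d034's `zetaTildeInv_eq_of_inputs` with `hΔS : IsAlmostPro`.  If every
prime lies in `Σ`, `Δ` is (vacuously) pro-`Σ` and the landed core applies; otherwise a prime `q ∉ Σ` makes `Δ` almost
pro-omissive through its open pro-`Σ` subgroup, and the landed argument ("`Θ = Δ`, `Λ/Θ ≅ Γ`") runs verbatim.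
[cite: MochizukiAbsTopI2012, Thm 2.6 (v) proof p.24] -/
theorem zetaTildeInv_eq_of_inputs_of_isAlmostPro [CompactSpace Λ] [T2Space Λ] (a : Λ →ₜ* Γ)
    (ha : Function.Surjective a)
    (hΓ : ∀ M : Subgroup Γ, M.Normal → IsClosed (M : Set Γ) → IsTopologicallyFinitelyGenerated M →
      IsAlmostProOmissive M → M = ⊥)
    (p : ℕ) [hp : Fact p.Prime] (D : ℕ) (hΓp : freeProlRank Γ p = ((1 + D : ℕ) : ℕ∞))
    (hΓl : ∀ (l : ℕ) [Fact l.Prime], l ≠ p → freeProlRank Γ l = 1)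
    {S : Set ℕ} (hS : S ⊆ {q | q.Prime})
    (hΔfg : IsTopologicallyFinitelyGenerated a.toMonoidHom.ker)
    (hΔS : IsAlmostPro a.toMonoidHom.ker S)
    (hQ : ∃ m : ℕ, ∀ (l : ℕ) [Fact l.Prime], l ∈ S → freeProlRank Λ l = freeProlRank Γ l + m)
    (hiii : thetaSet Λ 2 ⊆ {l ∈ S | l.Prime} ∧
      (2 ≤ (thetaSet Λ 1).encard → thetaSet Λ 2 = {l ∈ S | l.Prime})) :
    zetaTildeInv Λ = (D : ℕ∞) := by
  set Δ : Subgroup Λ := a.toMonoidHom.ker with hΔdef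
  have hΔc : IsClosed (Δ : Set Λ) := by
    rw [hΔdef, MonoidHom.coe_ker]
    exact isClosed_singleton.preimage a.continuous
  -- step one: almost pro-omissive tfg closed normal subgroups lie in `Δ`
  have step1 : ∀ N : Subgroup Λ, N.Normal → IsClosed (N : Set Λ) →
      IsTopologicallyFinitelyGenerated N → IsAlmostProOmissive N → N ≤ Δ :=
    fun N hN hNc hNfg hNapo => le_ker_of_isAlmostProOmissive a ha hΓ N hN hNc hNfg hNapo
  -- `ζ(Γ) = D`
  have hΓl' : ∀ (l : ℕ) [Fact l.Prime], l ≠ p → freeProlRank Γ l = ((1 : ℕ) : ℕ∞) := by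
    intro l _ hl; rw [hΓl l hl, Nat.cast_one]
  have ζΓ : zetaInv Γ = (D : ℕ∞) := zetaInv_eq_of_freeProlRank_eq p 1 D hΓp hΓl'
  by_cases hall : ∀ q : ℕ, q.Prime → q ∈ S
  · -- every prime lies in `Σ`: `Δ` is vacuously pro-`Σ`, the landed core applies
    exact zetaTildeInv_eq_of_inputs a ha hΓ p D hΓp hΓl hS hΔfg ⟨fun _ _ _ q hq _ => hall q hq⟩ hQ hiii
  · -- some prime `q ∉ Σ`: `Δ` is THE maximal subgroup, `Θ = Δ`, `Λ/Θ ≅ Γ`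
    push Not at hall
    obtain ⟨q, hq, hqS⟩ := hall
    have hΔapo : IsAlmostProOmissive Δ := hΔS.isAlmostProOmissive_of_prime_not_mem hS hq hqS
    have hΔmax : IsMaximalAPONormal Λ Δ :=
      ⟨⟨inferInstance, hΔc, hΔfg, hΔapo⟩,
        fun N' hn hc hfg hapo hle => le_antisymm (step1 N' hn hc hfg hapo) hle⟩
    have huniq : ∃! N : Subgroup Λ, IsMaximalAPONormal Λ N := by
      refine ⟨Δ, hΔmax, fun N hN => ?_⟩
      obtain ⟨⟨hn, hc, hfg, hapo⟩, hmax⟩ := hN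
      exact (hmax Δ inferInstance hΔc hΔfg hΔapo (step1 N hn hc hfg hapo)).symm
    have h2 : thetaSet Λ 2 ≠ {l | l.Prime} := by
      intro h
      have hq2 : q ∈ thetaSet Λ 2 := by rw [h]; exact hq
      exact hqS (hiii.1 hq2).1
    have hΘ : thetaSubgroup Λ = Δ := thetaSubgroup_eq_of_isMaximalAPONormal Λ h2 huniq hΔmax
    have hM : (thetaSubgroup Λ).normalCore = a.toMonoidHom.ker := by
      rw [normalCore_thetaSubgroup, hΘ]
    obtain ⟨e⟩ := nonempty_continuousMulEquiv_quotient_of_eq_ker_copy a ha _ hM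
    unfold zetaTildeInv
    rw [zetaInv_congr_of_freeProlRank_eq (fun q _ => freeProlRank_eq_of_continuousMulEquiv e q), ζΓ]


end Core

/-! ### The three general-`Θ` closers over `IsAlmostPro E.geom S` -/

namespace FundamentalExtension

variable {E : FundamentalExtension.{0}}

/-- For surjective `f`, `[f(G) : f(H)] = [G : H]` (finite) iff `Ker f ⊆ H` (copy of the private helper of
`AbsTopIThm26vFullClosers`). [folklore] -/
private theorem index_map_eq_iff_ker_le'' {G : Type u} {G' : Type v} [Group G] [Group G'] (f : G →* G')
    (hf : Function.Surjective f) (H : Subgroup G) [H.FiniteIndex] :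
    (H.map f).index = H.index ↔ f.ker ≤ H := by
  refine ⟨fun h => ?_, fun h => Subgroup.index_map_eq H hf h⟩
  have h1 : (H.map f).index = (H ⊔ f.ker).index := by
    rw [Subgroup.index_map, MonoidHom.range_eq_top.mpr hf, Subgroup.index_top, mul_one]
  rw [h1] at h
  have h2 : H.relIndex (H ⊔ f.ker) * (H ⊔ f.ker).index = H.index :=
    Subgroup.relIndex_mul_index le_sup_left
  rw [h] at h2
  have h3 : H.relIndex (H ⊔ f.ker) = 1 := by
    have hne : H.index ≠ 0 := Subgroup.FiniteIndex.index_ne_zero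
    have := h2
    nth_rw 2 [← one_mul H.index] at this
    exact Nat.eq_of_mul_eq_mul_right (Nat.pos_of_ne_zero hne) this
  exact le_sup_right.trans (Subgroup.relIndex_eq_one.mp h3)

/-- **`ζ̃(H) = [G : G_H] · [K : ℚ_p]` for every OPEN `H ⊆ Π`, `Δ` ALMOST pro-`Σ`** — abc-iut-w6-d034's
`MLFBase.zetaTildeInv_eq_of_isOpen` with the pro-`Σ` binder weakened to `IsAlmostPro E.geom S` (`Δ ∩ H` is almost
pro-`Σ` by `isAlmostPro_geom_inf_of_isOpen`; core `zetaTildeInv_eq_of_inputs_of_isAlmostPro`).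
[cite: MochizukiAbsTopI2012, Thm 2.6 (v) p.22] -/
theorem MLFBase.zetaTildeInv_eq_of_isOpen_of_isAlmostPro (B : E.MLFBase) (H : Subgroup E.arith)
    (hH : IsOpen (H : Set E.arith))
    {S : Set ℕ} (hS : S ⊆ {q | q.Prime}) (hΔ : E.GeomTFG) (hΔS : IsAlmostPro E.geom S)
    (hQ : ∃ m : ℕ, ∀ (l : ℕ) [Fact l.Prime], l ∈ S →
      freeProlRank H l = freeProlRank (H.map E.aug.toMonoidHom) l + m)
    (hiii : thetaSet H 2 ⊆ {l ∈ S | l.Prime} ∧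
      (2 ≤ (thetaSet H 1).encard → thetaSet H 2 = {l ∈ S | l.Prime})) :
    zetaTildeInv H =
      (((H.map E.aug.toMonoidHom).index * Module.finrank ℚ_[B.p] B.K : ℕ) : ℕ∞) := by
  letI := B.instPrime; letI := B.instField; letI := B.instAlgebra; letI := B.instFinite
  have hHc : IsClosed (H : Set E.arith) := H.isClosed_of_isOpen hH
  haveI : CompactSpace H := isCompact_iff_compactSpace.mp hHc.isCompact
  haveI : CompactSpace E.geom := isCompact_iff_compactSpace.mp E.isClosed_geom.isCompact
  -- the image `G_H ⊆ G`, open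
  set GH : Subgroup E.gal := H.map E.aug.toMonoidHom with hGHdef
  haveI : Finite (E.arith ⧸ H) := Subgroup.quotient_finite_of_isOpen H hH
  haveI : H.FiniteIndex := Subgroup.finiteIndex_of_finite_quotient
  haveI : GH.FiniteIndex :=
    ⟨fun h0 => Subgroup.FiniteIndex.index_ne_zero (H := H)
      (Nat.eq_zero_of_zero_dvd (h0 ▸ Subgroup.index_map_dvd H E.aug_surjective))⟩
  have hGHc : IsClosed (GH : Set E.gal) := by
    rw [hGHdef, Subgroup.coe_map]
    exact (hHc.isCompact.image (map_continuous E.aug)).isClosed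
  have hGHo : IsOpen (GH : Set E.gal) := GH.isOpen_of_isClosed_of_finiteIndex hGHc
  -- the restricted augmentation `H ↠ G_H`
  let a : H →ₜ* GH :=
    ⟨E.aug.toMonoidHom.subgroupMap H,
      Continuous.subtype_mk ((map_continuous E.aug).comp continuous_subtype_val) _⟩
  have ha : Function.Surjective a := E.aug.toMonoidHom.subgroupMap_surjective H
  -- `Ker(H ↠ G_H) = Δ ∩ H`
  have hmem : ∀ y : H, y ∈ a.toMonoidHom.ker ↔ (y : E.arith) ∈ E.geom := by
    intro y
    rw [MonoidHom.mem_ker, mem_geom, Subtype.ext_iff]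
    rfl
  let e : ↥(E.geom ⊓ H) ≃ₜ* ↥(a.toMonoidHom.ker) :=
    { toFun := fun x => ⟨⟨x.1, x.2.2⟩, (hmem _).2 x.2.1⟩
      invFun := fun y => ⟨y.1.1, ⟨(hmem _).1 y.2, y.1.2⟩⟩
      left_inv := fun _ => rfl
      right_inv := fun _ => rfl
      map_mul' := fun _ _ => rfl
      continuous_toFun :=
        Continuous.subtype_mk (Continuous.subtype_mk continuous_subtype_val _) _
      continuous_invFun :=
        Continuous.subtype_mk (continuous_subtype_val.comp continuous_subtype_val) _ }
  -- `Δ ∩ H` as an open subgroup of `Δ`: tfg and pro-`Σ`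
  let V : Subgroup E.geom := (E.geom ⊓ H).subgroupOf E.geom
  have hVo : IsOpen (V : Set E.geom) := by
    have hV : (V : Set E.geom) = Subtype.val ⁻¹' (H : Set E.arith) := by
      ext x
      simp only [V, SetLike.mem_coe, Subgroup.mem_subgroupOf, Subgroup.mem_inf, Set.mem_preimage]
      exact ⟨fun h => h.2, fun h => ⟨x.2, h⟩⟩
    rw [hV]
    exact hH.preimage continuous_subtype_val
  let e₀ : V ≃* ↥(E.geom ⊓ H) := Subgroup.subgroupOfEquivOfLe inf_le_left
  let e' : V ≃ₜ* ↥(E.geom ⊓ H) :=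
    { e₀ with
      continuous_toFun := by
        refine Continuous.subtype_mk ?_ _
        exact continuous_subtype_val.comp continuous_subtype_val
      continuous_invFun := by
        refine Continuous.subtype_mk (Continuous.subtype_mk continuous_subtype_val _) _ }
  have hΔHfg : IsTopologicallyFinitelyGenerated (a.toMonoidHom.ker) :=
    ((hΔ.subgroup_isOpen V hVo).of_continuousMulEquiv e').of_continuousMulEquiv e
  have hΔHS : IsAlmostPro (a.toMonoidHom.ker) S :=
    (E.isAlmostPro_geom_inf_of_isOpen hΔS H hH).of_continuousMulEquiv e
  -- LCFT ranks of `G_H`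
  obtain ⟨hl1, hp1⟩ := freeProlRank_map_aug_of_rank thm26_ii_delta_gal_holds E B H hH
  have hp1' : @freeProlRank GH _ _ B.p B.instPrime =
      ((1 + GH.index * Module.finrank ℚ_[B.p] B.K : ℕ) : ℕ∞) := by
    rw [hp1, Nat.add_comm]
  -- the core
  exact zetaTildeInv_eq_of_inputs_of_isAlmostPro a ha
    (fun M hn hc hfg hapo => MLFBase.eq_bot_of_isAlmostProOmissive_of_isOpen B GH hGHo M hn hc hfg hapo)
    B.p (GH.index * Module.finrank ℚ_[B.p] B.K) hp1' hl1 hS hΔHfg hΔHS hQ hiii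

/-- **`ζ̃(Π) = [K : ℚ_p]`** — the first sentence of [AbsTopI] Thm 2.6 (v), general `Θ` — for an
extension with MLF base data `G ≅ G_K`, GIVEN `Δ` tfg (Prop 2.2) and pro-`Σ`, the rank identity of
(ii) ("`δ¹_l(Π) = δ¹_l(G) + m` for `l ∈ Σ`") and (iii) (typed `thetaSet` clauses) for `Π`.
[cite: MochizukiAbsTopI2012, Thm 2.6 (v) p.22] -/
theorem MLFBase.zetaTildeInv_arith_eq_of_isAlmostPro (B : E.MLFBase) {S : Set ℕ} (hS : S ⊆ {q | q.Prime})
    (hΔ : E.GeomTFG) (hΔS : IsAlmostPro E.geom S)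
    (hQ : ∃ m : ℕ, ∀ (l : ℕ) [Fact l.Prime], l ∈ S →
      freeProlRank E.arith l = freeProlRank E.gal l + m)
    (hiii : thetaSet E.arith 2 ⊆ {l ∈ S | l.Prime} ∧
      (2 ≤ (thetaSet E.arith 1).encard → thetaSet E.arith 2 = {l ∈ S | l.Prime})) :
    zetaTildeInv E.arith = (Module.finrank ℚ_[B.p] B.K : ℕ) := by
  letI := B.instPrime; letI := B.instField; letI := B.instAlgebra; letI := B.instFinite
  have hR := thm26_ii_delta_gal_holds B.p B.K
  have hl1 : ∀ (l : ℕ) [Fact l.Prime], l ≠ B.p → freeProlRank E.gal l = 1 := by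
    intro l _ hl
    rw [freeProlRank_eq_of_continuousMulEquiv B.galIso l]
    exact hR.1 l hl
  have hp1 : @freeProlRank E.gal _ _ B.p B.instPrime =
      ((1 + Module.finrank ℚ_[B.p] B.K : ℕ) : ℕ∞) := by
    rw [freeProlRank_eq_of_continuousMulEquiv B.galIso B.p, hR.2, Nat.add_comm]
  exact zetaTildeInv_eq_of_inputs_of_isAlmostPro E.aug E.aug_surjective
    (fun M hn hc hfg hapo => MLFBase.eq_bot_of_isAlmostProOmissive B M hn hc hfg hapo)
    B.p (Module.finrank ℚ_[B.p] B.K) hp1 hl1 hS hΔ hΔS hQ hiii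


/-- **[AbsTopI] Thm 2.6 (v), GENERAL form — a closer for `E.Thm26vFull B` over a `Δ` that is only ALMOST pro-`Σ`**
(the Def 2.1 (i) datum), MODULO the same named inputs as abc-iut-w6-d034's `MLFBase.thm26vFull_of_rank_of_thm26iii_open`:
(I1) `E.GeomTFG`; (I2′) `IsAlmostPro E.geom S`, `Σ ⊆ 𝔓𝔯𝔦𝔪𝔢𝔰`; (I3) the rank identity of (ii) for every open `Π′ ⊆ Π`;
(I4) Thm 2.6 (iii) for every open `H ⊆ Π`.  Proof verbatim the landed one over the re-keyed `ζ̃` computations.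
[cite: MochizukiAbsTopI2012, Thm 2.6 (v) p.22] -/
theorem MLFBase.thm26vFull_of_rank_of_thm26iii_open_of_isAlmostPro (B : E.MLFBase) (S : Set ℕ)
    (hS : S ⊆ {q | q.Prime})
    (hΔ : E.GeomTFG) (hΔS : IsAlmostPro E.geom S)
    (hQ : ∀ (P : Subgroup E.arith), IsOpen (P : Set E.arith) → ∃ m : ℕ, ∀ (l : ℕ) [Fact l.Prime],
      l ∈ S → freeProlRank P l = freeProlRank (P.map E.aug.toMonoidHom) l + m)
    (hiii : ∀ (H : Subgroup E.arith), IsOpen (H : Set E.arith) →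
      thetaSet H 2 ⊆ {l ∈ S | l.Prime} ∧
        (2 ≤ (thetaSet H 1).encard → thetaSet H 2 = {l ∈ S | l.Prime})) :
    E.Thm26vFull B := by
  letI := B.instPrime; letI := B.instField; letI := B.instAlgebra; letI := B.instFinite
  set d : ℕ := Module.finrank ℚ_[B.p] B.K with hd
  have hd0 : d ≠ 0 := Module.finrank_pos.ne'
  -- `ζ̃(H) = [G : G_H] · d` for every open `H`
  have hζ : ∀ (H : Subgroup E.arith), IsOpen (H : Set E.arith) →
      zetaTildeInv H = (((H.map E.aug.toMonoidHom).index * d : ℕ) : ℕ∞) := fun H hH =>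
    MLFBase.zetaTildeInv_eq_of_isOpen_of_isAlmostPro B H hH hS hΔ hΔS (hQ H hH) (hiii H hH)
  -- `ζ̃(Π) = d`, transporting the inputs at `H = Π` along `⊤ ≅ Π`
  have htop : IsOpen ((⊤ : Subgroup E.arith) : Set E.arith) := by
    rw [Subgroup.coe_top]; exact isOpen_univ
  obtain ⟨e⟩ := nonempty_continuousMulEquiv_of_eq_top (⊤ : Subgroup E.arith) rfl
  obtain ⟨e'⟩ := nonempty_continuousMulEquiv_of_eq_top
    ((⊤ : Subgroup E.arith).map E.aug.toMonoidHom) (Subgroup.map_top_of_surjective _ E.aug_surjective)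
  have hQtop : ∃ m : ℕ, ∀ (l : ℕ) [Fact l.Prime], l ∈ S →
      freeProlRank E.arith l = freeProlRank E.gal l + m := by
    obtain ⟨m, hm⟩ := hQ ⊤ htop
    refine ⟨m, fun l _ hl => ?_⟩
    rw [← freeProlRank_eq_of_continuousMulEquiv e l, hm l hl, freeProlRank_eq_of_continuousMulEquiv e' l]
  have hiiitop : thetaSet E.arith 2 ⊆ {l ∈ S | l.Prime} ∧
      (2 ≤ (thetaSet E.arith 1).encard → thetaSet E.arith 2 = {l ∈ S | l.Prime}) := by
    have h := hiii ⊤ htop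
    rwa [thetaSet_eq_of_continuousMulEquiv e 2, thetaSet_eq_of_continuousMulEquiv e 1] at h
  have hζtop : zetaTildeInv E.arith = (d : ℕ∞) :=
    MLFBase.zetaTildeInv_arith_eq_of_isAlmostPro B hS hΔ hΔS hQtop hiiitop
  refine ⟨hζtop, ?_⟩
  -- the condition `ζ̃(H) = [Π : H] · ζ̃(Π)` for open `H` says `Δ ⊆ H`
  have hiff : ∀ (H : Subgroup E.arith), IsOpen (H : Set E.arith) →
      (zetaTildeInv H = (H.index : ℕ∞) * zetaTildeInv E.arith ↔ E.geom ≤ H) := fun H hH => by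
    haveI : Finite (E.arith ⧸ H) := Subgroup.quotient_finite_of_isOpen H hH
    haveI : H.FiniteIndex := Subgroup.finiteIndex_of_finite_quotient
    rw [hζ H hH, hζtop, ← Nat.cast_mul, ENat.coe_inj, geom_eq_ker]
    rw [show (H.map E.aug.toMonoidHom).index * d = H.index * d ↔
        (H.map E.aug.toMonoidHom).index = H.index from
      ⟨fun h' => Nat.eq_of_mul_eq_mul_right (Nat.pos_of_ne_zero hd0) h', fun h' => by rw [h']⟩]
    exact index_map_eq_iff_ker_le'' E.aug.toMonoidHom E.aug_surjective H
  -- `Δ` is the intersection of the open subgroups containing it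
  have hΔ' : E.geom = sInf {N : Subgroup E.arith | IsOpen (N : Set E.arith) ∧ E.geom ≤ N} :=
    ProfiniteGrp.closedSubgroup_eq_sInf_open E.geomClosed
  refine le_antisymm ?_ ?_
  · exact le_iInf fun H => le_iInf fun hH => le_iInf fun hHζ => (hiff H hH).mp hHζ
  · conv_rhs => rw [hΔ']
    refine le_sInf fun N hN => ?_
    exact iInf_le_of_le N (iInf_le_of_le hN.1 (iInf_le_of_le ((hiff N hN.1).mpr hN.2) le_rfl))

end FundamentalExtension

end Literature.AnabelianGeometry.AbsoluteAnabelian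

end
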